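import Mathlib

/-!
Record for crux stmt-BirchSwinnertonDyer-19215 (IDEATE-CENSUS-r1-k2 §2): the "realisation lemma".
A non-zero rational matrix applied to a ℚ-nondegenerate vector is non-zero.  Applied with
`lam j = log_p (e_j)` for a ℤ-basis `e_j` of `E(ℚ)/tors` (ℚ-nondegeneracy = the formal logarithm
kills only torsion), it says: the p-adic realisation `ι_{log_p} ω` of ANY non-zero rational
2-vector `ω ∈ ∧² (E(ℚ) ⊗ ℚ)` is non-zero at EVERY prime p — so the regulators of
Fornea–Gehrmann Conj. 2.15 / Darmon–Fornea Conj. 3.10 / Castella–Hsieh (1.3) carry no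
log-independence hypothesis.
-/

namespace Summit.BirchSwinnertonDyer.BirchSwinnertonDyer.Cruxes.SelmerCapAtOnePrime.Record

theorem mulVec_ne_zero_of_rat_nondegenerate {R : ℕ} {K : Type*} [Field K] [CharZero K]
    (A : Matrix (Fin R) (Fin R) ℚ) (lam : Fin R → K) (hA : A ≠ 0)
    (hlam : ∀ w : Fin R → ℚ, w ≠ 0 → ∑ j, (w j : K) * lam j ≠ 0) :
    (A.map (fun q : ℚ => (q : K))).mulVec lam ≠ 0 := by
  obtain ⟨i, hi⟩ : ∃ i, A i ≠ 0 := by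
    by_contra h
    push Not at h
    exact hA (Matrix.ext fun i j => by simpa using congrFun (h i) j)
  intro h0
  have hrow := congrFun h0 i
  simp only [Matrix.mulVec, dotProduct, Matrix.map_apply, Pi.zero_apply] at hrow
  exact hlam (A i) hi hrow

end Summit.BirchSwinnertonDyer.BirchSwinnertonDyer.Cruxes.SelmerCapAtOnePrime.Record
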